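import Literature.Computability.AlgebraicComplexity.PochhammerWilkinsonCHProofs
import Literature.Computability.AlgebraicComplexity.BurgisserThm41Proofs
import Literature.Computability.AlgebraicComplexity.RealTauConjectureDischarge
import HarnessLib

/-!
# Discharge of Bürgisser's transfer theorem (τ-conjecture ⇒ `τ(PER_n)` superpolynomial)

`not_isPBounded_constantFreeComplexity_perPoly_of_tauConjecture_holds`: the named fact
`Literature.Computability.AlgebraicComplexity.not_isPBounded_constantFreeComplexity_perPoly_of_tauConjecture`
(`TauConjecture.lean`; P. Bürgisser, *On defining integers and proving arithmetic circuit lower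
bounds*, Comput. Complexity 18 (2009) 81–103, Main Thm. 1.2 = ECCC TR06-113 (2006), Thm. 1.1(2)
= STACS 2007 (LNCS 4393, pp. 133–144), Thm. 1(2): "Each of the statements listed below implies
that the permanent of `n` by `n` matrices cannot be computed by constant-free and division-free
arithmetic circuits of size polynomial in `n`: that is, `τ(PER_n)` is not polynomially bounded in
`n`. … 2. The τ-conjecture of Shub and Smale is true.") is now a THEOREM of the tree, with no
hypothesis.

The proof is the printed one (ECCC TR06-113, proof of Thm. 1.1(2); STACS 2007, §5, proof of
Thm. 1): the Pochhammer–Wilkinson polynomials `f_n = ∏_{k=1}^{n} (X - k) = ∑_k b(n,k) X^k` have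
coefficients `b(n,k) = ± σ_{n-k}(1, …, n)` definable in the counting hierarchy `CH` (Cor. 3.9 of
the ECCC version = STACS Cor. 15, iterated multiplication in `CH`, Thm. 3.7), hence by
Thm. 4.1(2) (= STACS Thm. 16(2)) the hypothesis `τ(PER_n) = n^{O(1)}` gives
`τ(2^{e(n)} f_n) = (log n)^{O(1)}` for some polynomially bounded `e`; but `2^{e(n)} f_n` has the
`n` distinct integer roots `1, …, n`, contradicting the τ-conjecture for `n = 2^m` large.
Every step is a theorem of the tree:

* Cor. 3.9 — `Burgisser2009_esymm_chDefinable_holds` and its coefficient form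
  `Burgisser2009_pochhammerWilkinson_coeff_chDefinable_holds` (`PochhammerWilkinsonCHProofs.lean`,
  on top of the scaled Hesse–Allender–Barrington iterated-multiplication calculus
  `Complexity/CH*.lean` and the block extraction `EsymmFromProductBits.lean`);
* Thm. 4.1(2) — `Burgisser2009_thm41_2_uniform_holds` (`BurgisserThm41Proofs.lean`): Lemma 2.12
  (`τ(PER)` polynomially bounded ⇒ `PP ⊆ P/poly`, `PP_subset_PPoly_of_isPBounded_perPoly_holds`),
  Lemma 2.5(2) (`PP ⊆ P/poly ⇒ CH ⊆ P/poly`, `CH_subset_PPoly_of_PP_subset_PPoly_holds`), Thm. 2.10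
  (constant-free `VNP⁰`-completeness of `PER` in τ-form, `Burgisser2009_thm210_holds`) and the
  application of Koiran's criterion Thm. 2.11 (`Burgisser2009_thm41_koiranStep_holds`);
* the final root count / growth argument —
  `not_isPBounded_constantFreeComplexity_perPoly_of_tauConjecture_of` (`TauConjectureProofs.lean`).

(The alternative assembly `not_isPBounded_constantFreeComplexity_perPoly_of_tauConjecture_of_two_facts`
of `TauConjectureTwoFacts.lean` is likewise closed, Valiant's `#P`-hardness of the `0/1`
permanent being the tree theorem `Valiant1979_per01Plain_isSharpPHardFun_holds`,
`QuantumComplexity/PermanentHardnessProofs.lean`; it is not imported here.)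

Also recorded: the unfolded statement and the disjunctive packaging with the (already
discharged) Koiran–Tavenas real-τ transfer theorem
`not_isPBounded_constantFreeComplexity_perPoly_of_realTauConjecture_holds`
(`RealTauConjectureDischarge.lean`).

## References

* P. Bürgisser, *On defining integers and proving arithmetic circuit lower bounds*, Comput.
  Complexity 18 (2009) 81–103, Main Thm. 1.2, Lemma 2.5, Thm. 2.10, Thm. 2.11, Lemma 2.12,
  Thm. 3.7, Cor. 3.9, Thm. 4.1(2); = ECCC TR06-113 (2006), Thm. 1.1(2); conference version
  STACS 2007, LNCS 4393, pp. 133–144, Thm. 1(2), Cor. 15, Thm. 16(2).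
* M. Shub, S. Smale, *On the intractability of Hilbert's Nullstellensatz and an algebraic
  version of "NP ≠ P?"*, Duke Math. J. 81 (1995) 47–54 (the τ-conjecture).
* S. Tavenas, PhD thesis, ENS Lyon 2014, Thm. 3.3 (real τ-conjecture analogue).
-/

namespace Literature.Computability.AlgebraicComplexity

/-- **Bürgisser's transfer theorem, DISCHARGED** (Comput. Complexity 18 (2009), Main Thm. 1.2 =
ECCC TR06-113 Thm. 1.1(2) = STACS 2007 Thm. 1(2)): if the Shub–Smale τ-conjecture holds, then
`τ(PER_n)` — the constant-free division-free arithmetic circuit complexity of the generic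
`n × n` permanent over `ℤ` — is not polynomially bounded in `n`. Printed proof: the coefficients
of `∏_{k ≤ n} (X - k)` are definable in `CH` (Cor. 3.9), so Thm. 4.1(2) applies, and the `n`
integer roots contradict the τ-conjecture. [cite: Burgisser2009, Main Thm. 1.2] -/
theorem not_isPBounded_constantFreeComplexity_perPoly_of_tauConjecture_holds :
    not_isPBounded_constantFreeComplexity_perPoly_of_tauConjecture :=
  not_isPBounded_constantFreeComplexity_perPoly_of_tauConjecture_of
    Burgisser2009_pochhammerWilkinson_coeff_chDefinable_holds Burgisser2009_thm41_2_uniform_holds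

/-- Bürgisser's transfer theorem, unfolded: the Shub–Smale τ-conjecture implies that
`n ↦ τ(PER_n)` is not p-bounded. [cite: Burgisser2009, Main Thm. 1.2] -/
theorem not_isPBounded_constantFreeComplexity_perPoly_of_shubSmaleTauConjecture
    (h : ShubSmaleTauConjecture) :
    ¬ IsPBounded fun n => constantFreeComplexity (perPoly (Fin n) ℤ) :=
  not_isPBounded_constantFreeComplexity_perPoly_of_tauConjecture_holds h

/-- **Either τ-conjecture rules out polynomial-size constant-free circuits for the permanent**
(Bürgisser 2009, Main Thm. 1.2, for the Shub–Smale τ-conjecture; Tavenas 2014, Thm. 3.3 =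
Koiran 2011, §6, for the real τ-conjecture) — both transfer theorems being discharged, the
disjunctive packaging `not_isPBounded_constantFreeComplexity_perPoly_of_or` of `TauConjecture.lean`
holds outright. [cite: Burgisser2009, Main Thm. 1.2] [cite: Tavenas2014, Thm. 3.3] -/
theorem not_isPBounded_constantFreeComplexity_perPoly_of_either_tauConjecture
    (h : ShubSmaleTauConjecture ∨ KoiranRealTauConjecture) :
    ¬ IsPBounded fun n => constantFreeComplexity (perPoly (Fin n) ℤ) :=
  not_isPBounded_constantFreeComplexity_perPoly_of_or
    not_isPBounded_constantFreeComplexity_perPoly_of_tauConjecture_holds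
    not_isPBounded_constantFreeComplexity_perPoly_of_realTauConjecture_holds h

end Literature.Computability.AlgebraicComplexity
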